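import Summits.NavierStokesRegularity.FluidComputer.TubeTableFat18Run0
import Summits.NavierStokesRegularity.FluidComputer.TubeTableFat18Run1
import Summits.NavierStokesRegularity.FluidComputer.TubeTableFat18Run2
import Summits.NavierStokesRegularity.FluidComputer.TubeTableFat18Run3
import Summits.NavierStokesRegularity.FluidComputer.TubeTableFat18Run4
import Summits.NavierStokesRegularity.FluidComputer.TubeRestart
import HarnessLib

/-!
# The fat restart tube as a certified CROSSING stage (bp3 gen 15)

HONEST FRAMING: low prior, high value-of-information experiment on Tao's machine paradigm; NOT a
claim that NS blows up.
Everything here concerns the 5-mode quadratic, energy-conserving TRUNCATION `thresholdCircuit` with an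
ABSTRACT forcing of sup-size `δ`; nothing is proved about the Navier–Stokes equations.

`run_allF` composes the 30 kernel chunk theorems; `fatSlice18_crossing`: every `Gt.δ`-forced window of
duration `TF = 329/512` from the FAT slice `FatSlice18` (slice 18 of the design tube with the rotor ellipse
`× 12`; it contains the thin slice, `slice18_subset`) stays in the cube `‖·‖∞ ≤ Rbt` and crosses the
read-out level `C₋` with `(a, b, d, ã)` in the hull `HF` (`ã ∈ [0.033686, 0.038452]` vs the design
tube's `[0.035239, 0.036849]`); `fatSlice18_handoff`: with the energy band of time `tT 18` the crossing
state lies in the entry box `Bc0F` of the re-cut stage-3 table.  WHAT IS NOT HERE: the re-cut level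
table itself is NOT in the tree (exact-rational twin only: alive 1400/1400, `ã² ≥ 0.9200 c²`), so no
reach-to-output theorem is stated for the fat slice; and nothing certifies the RAMP that brings a
downstream gate INTO `FatSlice18` (bp3 gen 15 measured that it lands there in the 9-mode chain model).

[cite: Tao2016AveragedNS, §5.5 Thm 5.3 (5.5)]
-/

noncomputable section

open Set

namespace Summit.NavierStokesRegularity.FluidComputer

open Literature.Analysis.FluidPDE.Tao2016AveragedNS
open Literature.Analysis.FluidPDE.FluidComputer
open Literature.Analysis.FluidPDE.FluidComputer.TubeTable
open Literature.Analysis.FluidPDE.FluidComputer.ThresholdLevelTable (GIt Gt Gt_valid GIt_mem Rbt)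
open TubeTableFat18

namespace TubeStage

/-- The whole fat run: all 30 chunks pass. [folklore] -/
theorem run_allF : runTube 60 12 GIt CLt Rt (sF 0) schedF = some (sF NF) :=
  runTube_chunks sF cF NF (by
    intro i hi
    simp only [NF] at hi
    interval_cases i
    · exact runF_0
    · exact runF_1
    · exact runF_2
    · exact runF_3
    · exact runF_4
    · exact runF_5
    · exact runF_6
    · exact runF_7
    · exact runF_8
    · exact runF_9
    · exact runF_10
    · exact runF_11
    · exact runF_12
    · exact runF_13
    · exact runF_14
    · exact runF_15
    · exact runF_16
    · exact runF_17
    · exact runF_18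
    · exact runF_19
    · exact runF_20
    · exact runF_21
    · exact runF_22
    · exact runF_23
    · exact runF_24
    · exact runF_25
    · exact runF_26
    · exact runF_27
    · exact runF_28
    · exact runF_29
)

/-- **The fat slice** (real form of `B0F`). [folklore] -/
def FatSlice18 : Set (Fin 5 → ℝ) := {X | (B0F.toR 60).mem X}

/-- The thin slice lies in the fat one. [folklore] -/
theorem slice18_subset : Slice 18 ⊆ FatSlice18 := by
  intro X hX
  obtain ⟨ha, hb, hc, hV⟩ := hX
  refine ⟨?_, ?_, ?_, ?_⟩
  · simpa [B0F, TubeBoxD.toR, sT] using ha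
  · simpa [B0F, TubeBoxD.toR, sT] using hb
  · simpa [B0F, TubeBoxD.toR, sT] using hc
  · simp only [B0F, TubeBoxD.toR, sT] at hV ⊢
    push_cast at hV ⊢
    nlinarith [hV, sq_nonneg (X 3 - 1849541768375140 / 2 ^ 60), sq_nonneg (X 4 - 11194784220703146 / 2 ^ 60)]

/-- `tT 18 = 900/2048` and `tT 18 + TF = T12t + 2⁻¹³`. [folklore] -/
theorem tT_18 : tT 18 = 900 / 2048 := by
  rw [tT]; norm_num [Finset.sum_range_succ, Finset.sum_range_zero, cT, dur_replicate]

/-- **CROSSING FROM THE FAT SLICE.** [folklore] -/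
theorem fatSlice18_crossing {y : ℝ → Fin 5 → ℝ}
    (hW : IsForcedWindow Gt.ε Gt.σ Gt.ν Gt.μ Gt.r Gt.κ Gt.δ TF y) (h0 : y 0 ∈ FatSlice18) :
    (∀ t ∈ Icc 0 TF, ∀ i, |y t i| ≤ Rbt) ∧
      ∃ s ∈ Ico 0 TF, y s 2 = Cminus ∧ HF.memR 60 (y s) := by
  rw [← dur_schedF] at hW
  have h := runTube_crossing (P := 60) (n := 12) (by norm_num) GIt_mem Gt_valid run_allF
    schedF_ne_nil levels_ltF.1 levels_ltF.2 hW h0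
  rw [dur_schedF, Rt_eq] at h
  exact h

/-- **HAND-OFF FROM THE FAT SLICE** into the entry box `Bc0F` of the re-cut table (which is NOT in the
tree: twin only). [folklore] -/
theorem fatSlice18_handoff {y : ℝ → Fin 5 → ℝ}
    (hW : IsForcedWindow Gt.ε Gt.σ Gt.ν Gt.μ Gt.r Gt.κ Gt.δ TF y) (h0 : y 0 ∈ FatSlice18)
    (hE : y 0 ∈ energyBand 18) :
    ∃ s ∈ Ico 0 TF, (Bc0F.toReal 60).mem Gt.κ Gt.r Cminus (y s) := by
  obtain ⟨hcube, s, hs, hc, hH⟩ := fatSlice18_crossing hW h0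
  refine ⟨s, hs, ?_⟩
  obtain ⟨⟨ha1, ha2⟩, ⟨hb1, hb2⟩, ⟨hd1, hd2⟩, ⟨hz1, hz2⟩⟩ := hH
  simp only [HF] at ha1 ha2 hb1 hb2 hd1 hd2 hz1 hz2
  push_cast at ha1 ha2 hb1 hb2 hd1 hd2 hz1 hz2
  have hc' : y s 2 = (117685124146233 : ℝ) / 2 ^ 60 := by rw [hc]; norm_num [Cminus, CLt]
  have hw := slavingResidual_mem_of_box (κ := Gt.κ) (r := Gt.r) (by norm_num [Gt]) (by norm_num [Gt])
    (by norm_num) (by norm_num) (by norm_num) (by norm_num) ⟨ha1, ha2⟩ ⟨hc'.ge, hc'.le⟩ ⟨hd1, hd2⟩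
    ⟨hz1, hz2⟩
  simp only [Gt] at hw
  have hdrift := hW.energy_abs_sub_le (R := Rbt) (by norm_num [Rbt])
    (fun t ht i => hcube t ⟨ht.1, ht.2.le⟩ i) s ⟨hs.1, hs.2.le⟩
  obtain ⟨hdr1, hdr2⟩ := abs_le.1 hdrift
  have hKs : 10 * (Gt.δ * Rbt) * s ≤ 10 * (Gt.δ * Rbt) * TF :=
    mul_le_mul_of_nonneg_left hs.2.le (by norm_num [Gt, Rbt])
  have F1 : (1152852475459689027 : ℝ) / 2 ^ 60 ≤
      E0lo - 10 * (Gt.δ * Rbt) * (900 / 2048) - 10 * (Gt.δ * Rbt) * TF := by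
    norm_num [E0lo, Gt, Rbt, TF]
  have F2 : E0hi + 10 * (Gt.δ * Rbt) * (900 / 2048) + 10 * (Gt.δ * Rbt) * TF ≤
      (1152990534186362019 : ℝ) / 2 ^ 60 := by
    norm_num [E0hi, Gt, Rbt, TF]
  obtain ⟨hE1, hE2⟩ := hE
  rw [tT_18] at hE1 hE2
  refine ⟨⟨?_, ?_⟩, ⟨?_, ?_⟩, ?_, ⟨?_, ?_⟩, ⟨?_, ?_⟩, ⟨?_, ?_⟩⟩
  all_goals try simp only [LevelEntryD.toReal, Bc0F]
  all_goals try push_cast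
  · exact ha1
  · exact ha2
  · exact hb1
  · exact hb2
  · exact hc'.trans (by norm_num [Cminus, CLt])
  · simp only [Gt]; linarith [hw.1]
  · simp only [Gt]; linarith [hw.2]
  · exact hz1
  · exact hz2
  · linarith
  · linarith

end TubeStage

end Summit.NavierStokesRegularity.FluidComputer

end
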